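import Mathlib
import HarnessLib

/-!
# Stub `stub_recursionExponent` of line `ip-passage-stirling`
(crux `CardyBoundaryCoulombGas.HalfPlaneOneArmThird`, stmt-CriticalPhenomena-5662)

Pure real analysis. A sequence `u : ℕ → ℝ` with `u 0 = 1` satisfying Ikhlef–Ponsaing's two-step
recursion in ratio form,
`u (m+1) · (3m+4)(4m+7)(6m+5) = u m · (3m+5)(4m+3)(6m+7)`,
has `log (u m) / log m → -1/3` (the Gamma-ratio exponent `(5/3+3/4+7/6) - (4/3+7/4+5/6) = -1/3`).

Proof (elementary, no Gamma functions). Write `N m = (3m+5)(4m+3)(6m+7)` and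
`D m = (3m+4)(4m+7)(6m+5) > 0`, so `u (m+1) = u m · N m / D m` and `u m > 0` by induction.
1. The polynomials `(x+1) D(x)³ - N(x)³ (x+2)` and `N(x)³ (2x+3) - (2x+1) D(x)³` have non-negative
   coefficients, so `u m ^ 3 · (m+1)` is non-increasing and `u m ^ 3 · (2m+1)` is non-decreasing in
   `m`; both equal `1` at `m = 0`, whence `1/(2m+1) ≤ u m ^ 3 ≤ 1/(m+1)`.
2. Taking logarithms, `-(log 3 + log m) ≤ 3 log (u m) ≤ -log m` for `m ≥ 1`; dividing by
   `log m → +∞` squeezes `log (u m) / log m` between `-1/3 - (log 3 / 3) / log m → -1/3` and `-1/3`.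
-/

namespace Summit.CriticalPhenomena.CardyFormulaZ2.Cruxes.HalfPlaneOneArmThird.IpPassageStirling

open Filter Topology

/-- Upper polynomial inequality: `N(x)³ (x+2) ≤ (x+1) D(x)³` for `x ≥ 0`
(the difference is a polynomial with non-negative coefficients). -/
private theorem recExp_poly_upper (x : ℝ) (hx : 0 ≤ x) :
    ((3 * x + 5) * (4 * x + 3) * (6 * x + 7)) ^ 3 * (x + 2) ≤
      (x + 1) * ((3 * x + 4) * (4 * x + 7) * (6 * x + 5)) ^ 3 := by
  have hQ : 0 ≤ 428750 + 2960825 * x + 8831235 * x ^ 2 + 14862058 * x ^ 3 + 15438042 * x ^ 4 +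
      10138248 * x ^ 5 + 4111560 * x ^ 6 + 941760 * x ^ 7 + 93312 * x ^ 8 := by positivity
  have key : (x + 1) * ((3 * x + 4) * (4 * x + 7) * (6 * x + 5)) ^ 3 =
      ((3 * x + 5) * (4 * x + 3) * (6 * x + 7)) ^ 3 * (x + 2) +
      (428750 + 2960825 * x + 8831235 * x ^ 2 + 14862058 * x ^ 3 + 15438042 * x ^ 4 +
        10138248 * x ^ 5 + 4111560 * x ^ 6 + 941760 * x ^ 7 + 93312 * x ^ 8) := by
    ring
  linarith [key, hQ]

/-- Lower polynomial inequality: `(2x+1) D(x)³ ≤ N(x)³ (2x+3)` for `x ≥ 0`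
(the difference is a polynomial with non-negative coefficients). -/
private theorem recExp_poly_lower (x : ℝ) (hx : 0 ≤ x) :
    (2 * x + 1) * ((3 * x + 4) * (4 * x + 7) * (6 * x + 5)) ^ 3 ≤
      ((3 * x + 5) * (4 * x + 3) * (6 * x + 7)) ^ 3 * (2 * x + 3) := by
  have hQ : 0 ≤ 728875 + 5143775 * x + 15679125 * x ^ 2 + 26955724 * x ^ 3 + 28587384 * x ^ 4 +
      19154304 * x ^ 5 + 7920720 * x ^ 6 + 1848960 * x ^ 7 + 186624 * x ^ 8 := by positivity
  have key : ((3 * x + 5) * (4 * x + 3) * (6 * x + 7)) ^ 3 * (2 * x + 3) =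
      (2 * x + 1) * ((3 * x + 4) * (4 * x + 7) * (6 * x + 5)) ^ 3 +
      (728875 + 5143775 * x + 15679125 * x ^ 2 + 26955724 * x ^ 3 + 28587384 * x ^ 4 +
        19154304 * x ^ 5 + 7920720 * x ^ 6 + 1848960 * x ^ 7 + 186624 * x ^ 8) := by
    ring
  linarith [key, hQ]

/-- The recursion in ratio form: `u (m+1) = u m · N m / D m`. -/
private theorem recExp_succ (u : ℕ → ℝ)
    (hrec : ∀ m : ℕ, u (m + 1) * ((3 * (m : ℝ) + 4) * (4 * (m : ℝ) + 7) * (6 * (m : ℝ) + 5)) =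
      u m * ((3 * (m : ℝ) + 5) * (4 * (m : ℝ) + 3) * (6 * (m : ℝ) + 7))) (m : ℕ) :
    u (m + 1) = u m * (((3 * (m : ℝ) + 5) * (4 * (m : ℝ) + 3) * (6 * (m : ℝ) + 7)) /
      ((3 * (m : ℝ) + 4) * (4 * (m : ℝ) + 7) * (6 * (m : ℝ) + 5))) := by
  have hD : (0 : ℝ) < (3 * (m : ℝ) + 4) * (4 * (m : ℝ) + 7) * (6 * (m : ℝ) + 5) := by positivity
  rw [mul_div_assoc', eq_div_iff hD.ne']
  exact hrec m

/-- Positivity of the solution: `0 < u m`. -/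
private theorem recExp_pos (u : ℕ → ℝ) (h0 : u 0 = 1)
    (hrec : ∀ m : ℕ, u (m + 1) * ((3 * (m : ℝ) + 4) * (4 * (m : ℝ) + 7) * (6 * (m : ℝ) + 5)) =
      u m * ((3 * (m : ℝ) + 5) * (4 * (m : ℝ) + 3) * (6 * (m : ℝ) + 7))) (m : ℕ) :
    0 < u m := by
  induction m with
  | zero => rw [h0]; exact one_pos
  | succ m ih =>
    rw [recExp_succ u hrec m]
    positivity

/-- Upper envelope: `u m ^ 3 · (m+1) ≤ 1` (the quantity is non-increasing and equals `1` at `0`). -/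
private theorem recExp_cube_upper (u : ℕ → ℝ) (h0 : u 0 = 1)
    (hrec : ∀ m : ℕ, u (m + 1) * ((3 * (m : ℝ) + 4) * (4 * (m : ℝ) + 7) * (6 * (m : ℝ) + 5)) =
      u m * ((3 * (m : ℝ) + 5) * (4 * (m : ℝ) + 3) * (6 * (m : ℝ) + 7))) (m : ℕ) :
    u m ^ 3 * ((m : ℝ) + 1) ≤ 1 := by
  induction m with
  | zero => simp [h0]
  | succ m ih =>
    have hu : 0 < u m := recExp_pos u h0 hrec m
    have hD : (0 : ℝ) < (3 * (m : ℝ) + 4) * (4 * (m : ℝ) + 7) * (6 * (m : ℝ) + 5) := by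
      positivity
    have step : u (m + 1) ^ 3 * ((m : ℝ) + 2) ≤ u m ^ 3 * ((m : ℝ) + 1) := by
      rw [recExp_succ u hrec m, mul_pow, div_pow, mul_assoc]
      refine mul_le_mul_of_nonneg_left ?_ (pow_nonneg hu.le 3)
      rw [div_mul_eq_mul_div, div_le_iff₀ (pow_pos hD 3)]
      exact recExp_poly_upper m (Nat.cast_nonneg m)
    push_cast
    linarith

/-- Lower envelope: `1 ≤ u m ^ 3 · (2m+1)` (the quantity is non-decreasing, equals `1` at `0`). -/
private theorem recExp_cube_lower (u : ℕ → ℝ) (h0 : u 0 = 1)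
    (hrec : ∀ m : ℕ, u (m + 1) * ((3 * (m : ℝ) + 4) * (4 * (m : ℝ) + 7) * (6 * (m : ℝ) + 5)) =
      u m * ((3 * (m : ℝ) + 5) * (4 * (m : ℝ) + 3) * (6 * (m : ℝ) + 7))) (m : ℕ) :
    1 ≤ u m ^ 3 * (2 * (m : ℝ) + 1) := by
  induction m with
  | zero => simp [h0]
  | succ m ih =>
    have hu : 0 < u m := recExp_pos u h0 hrec m
    have hD : (0 : ℝ) < (3 * (m : ℝ) + 4) * (4 * (m : ℝ) + 7) * (6 * (m : ℝ) + 5) := by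
      positivity
    have step : u m ^ 3 * (2 * (m : ℝ) + 1) ≤ u (m + 1) ^ 3 * (2 * (m : ℝ) + 3) := by
      rw [recExp_succ u hrec m, mul_pow, div_pow, mul_assoc]
      refine mul_le_mul_of_nonneg_left ?_ (pow_nonneg hu.le 3)
      rw [div_mul_eq_mul_div, le_div_iff₀ (pow_pos hD 3)]
      exact recExp_poly_lower m (Nat.cast_nonneg m)
    push_cast
    linarith

/-- **S2** `stub_recursionExponent`. A solution `u` of Ikhlef–Ponsaing's two-step recursion
`u (m+1) · (3m+4)(4m+7)(6m+5) = u m · (3m+5)(4m+3)(6m+7)` with `u 0 = 1` has power-law decay of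
exponent `-1/3`: `log (u m) / log m → -1/3` (in fact `1/(2m+1) ≤ u m ^ 3 ≤ 1/(m+1)`). -/
theorem stub_recursionExponent :
    ∀ u : ℕ → ℝ, u 0 = 1 →
      (∀ m : ℕ, u (m + 1) * ((3 * (m : ℝ) + 4) * (4 * (m : ℝ) + 7) * (6 * (m : ℝ) + 5)) =
        u m * ((3 * (m : ℝ) + 5) * (4 * (m : ℝ) + 3) * (6 * (m : ℝ) + 7))) →
      Tendsto (fun m : ℕ ↦ Real.log (u m) / Real.log m) atTop (𝓝 (-(1 / 3 : ℝ))) := by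
  intro u h0 hrec
  have hlog : Tendsto (fun m : ℕ ↦ Real.log (m : ℝ)) atTop atTop :=
    Real.tendsto_log_atTop.comp tendsto_natCast_atTop_atTop
  -- the lower envelope `-1/3 - (log 3 / 3) / log m → -1/3`
  have hlow : Tendsto (fun m : ℕ ↦ -(1 / 3 : ℝ) - Real.log 3 / 3 / Real.log (m : ℝ)) atTop
      (𝓝 (-(1 / 3 : ℝ))) := by
    have h1 : Tendsto (fun m : ℕ ↦ Real.log 3 / 3 / Real.log (m : ℝ)) atTop (𝓝 0) :=
      tendsto_const_nhds.div_atTop hlog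
    have h2 := (tendsto_const_nhds : Tendsto (fun _ : ℕ ↦ (-(1 / 3 : ℝ))) atTop
      (𝓝 (-(1 / 3 : ℝ)))).sub h1
    rwa [sub_zero] at h2
  refine tendsto_of_tendsto_of_tendsto_of_le_of_le' hlow tendsto_const_nhds ?_ ?_
  · -- lower bound, from `1 ≤ u m ^ 3 (2m+1)` and `2m+1 ≤ 3m`
    filter_upwards [eventually_ge_atTop 2] with m hm
    have hm1 : (1 : ℝ) < m := by exact_mod_cast (by omega : 1 < m)
    have hm0 : (0 : ℝ) < m := by linarith
    have hlogm : 0 < Real.log (m : ℝ) := Real.log_pos hm1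
    have hu : 0 < u m := recExp_pos u h0 hrec m
    have h2 : 0 ≤ 3 * Real.log (u m) + Real.log (2 * (m : ℝ) + 1) := by
      have := Real.log_le_log one_pos (recExp_cube_lower u h0 hrec m)
      rw [Real.log_one, Real.log_mul (pow_pos hu 3).ne' (show (2 * (m : ℝ) + 1) ≠ 0 by positivity),
        Real.log_pow] at this
      exact_mod_cast this
    have h3 : Real.log (2 * (m : ℝ) + 1) ≤ Real.log 3 + Real.log (m : ℝ) := by
      have h := Real.log_le_log (show (0 : ℝ) < 2 * (m : ℝ) + 1 by positivity)
        (show 2 * (m : ℝ) + 1 ≤ 3 * m by linarith)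
      rwa [Real.log_mul (by norm_num) hm0.ne'] at h
    rw [le_div_iff₀ hlogm, sub_mul, div_mul_cancel₀ _ hlogm.ne']
    linarith
  · -- upper bound, from `u m ^ 3 (m+1) ≤ 1` and `m ≤ m+1`
    filter_upwards [eventually_ge_atTop 2] with m hm
    have hm1 : (1 : ℝ) < m := by exact_mod_cast (by omega : 1 < m)
    have hm0 : (0 : ℝ) < m := by linarith
    have hlogm : 0 < Real.log (m : ℝ) := Real.log_pos hm1
    have hu : 0 < u m := recExp_pos u h0 hrec m
    have h2 : 3 * Real.log (u m) + Real.log ((m : ℝ) + 1) ≤ 0 := by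
      have := Real.log_le_log (by positivity) (recExp_cube_upper u h0 hrec m)
      rw [Real.log_one, Real.log_mul (pow_pos hu 3).ne' (show ((m : ℝ) + 1) ≠ 0 by positivity),
        Real.log_pow] at this
      exact_mod_cast this
    have h3 : Real.log (m : ℝ) ≤ Real.log ((m : ℝ) + 1) :=
      Real.log_le_log hm0 (by linarith)
    rw [div_le_iff₀ hlogm]
    linarith

end Summit.CriticalPhenomena.CardyFormulaZ2.Cruxes.HalfPlaneOneArmThird.IpPassageStirling
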